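import Summits.SmoothPoincare4.SmoothPoincare4.Theorems.CylinderEntropyImmortalAreaToFloor
import Summits.SmoothPoincare4.SmoothPoincare4.Theorems.CylinderEntropyCylinderRungTwoUpperDensityOfFloor
import Summits.SmoothPoincare4.SmoothPoincare4.Theorems.CylinderEntropyCylinderRungTwoCrossingParityOfPocket
import Summits.SmoothPoincare4.SmoothPoincare4.Theorems.CylinderEntropyCylinderRungTwoParabolicAreaFloor
import Summits.SmoothPoincare4.SmoothPoincare4.Theorems.CylinderEntropyCylinderRungTwoParityCounting
import HarnessLib

/-!
# Route `CylinderEntropy`, crux `CylinderRungTwo` (stmt-SmoothPoincare4-7631), line `killing-flux`: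
# NULL SURVIVORS DIE — THE PROOF (lead c7, r21)

**Theorem (`helper_nullSurvivorsDiePocket`, the skeleton's `nullSurvivorsDie_pocket` verbatim).**  There is no
immortal smooth mean curvature flow `IsCylinderMCF P F ν T` of a compact connected cross-section of
`N = S⁴ × ℝ ⊂ ℝ⁶` with cylinder entropy `λ_cyl < 2` along the flow whose slices NEVER separate the two ends of `N`
and each have a POCKET (a point of the complement in `N` that cannot be joined, inside the complement, to the lower
end).  This is the degree-`0` twin of the route crux `ImmortalAreaToFloor` (stmt-SmoothPoincare4-17197, PROVED:
`areaToFloor`, p144604) and it closes the last GMT stub of line `killing-flux` outright: the static lemma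
`stub_nullThinStatic` (r18/r20) is no longer needed.

Proof (Allard-free, word for word the proof of `areaToFloor` up to its last step).  Fix the universal constants
(Besicovitch `N`, cutoff constants), the flow constants — uniform upper Gaussian density `2 - δ₀` at late times for
scales `≤ τ_max`, now from the AREA-FLOOR form `helper_upperGaussianDensityLateOfFloor` (p148054) fed by THE PARABOLIC
AREA FLOOR `helper_volLeAreaAlongCylinderFlow` (p138658: `vol ≤ μH⁴(F_t P)` along every immortal cylinder flow of a
non-empty closed cross-section) instead of separation; Ahlfors growth; height bound; initial area — and the stacking
parameters (tilt threshold `ξ ≤ 1/4`).  At a late time `r` with heights within `g_max/2` of a constant and small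
Willmore energy take the GOOD SET `G` of the slice: its complement has area `≤ κ₄ vol/4`, its shadow is INJECTIVE
(`shadow_injOn_of_good`: no two good points on one vertical) and `|ν₅| ≥ 1 - ξ` on it.  NEW LAST STEP: the slice
does not separate and has a pocket, so along a.e. vertical line it has AS MANY UPWARD AS DOWNWARD CROSSINGS
(`helper_crossingParityOfPocket`, p144812 — the Jordan–Brouwer-free crossing count of wave 1); a set with injective
shadow meets a.e. fibre in at most one point, and a fibre it meets has `2 #F₊ ≥ 2` points, so the good set is
DOMINATED BY THE BAD SET: `(1 - ξ) μ(G) ≤ μ(Gᶜ)` (`helper_parityCounting`, the degree-`0` counting lemma).  Hence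
`κ₄ vol ≤ κ₄ μH⁴(F_r P) = μ(P) ≤ μ(G) + μ(Gᶜ) ≤ (7/3) κ₄ vol/4 < κ₄ vol` — a contradiction with the parabolic area
floor.

References: W. K. Allard, Ann. of Math. 95 (1972) §6; R. S. Hamilton, Comm. Anal. Geom. 1 (1993); T. H. Colding,
W. P. Minicozzi II, Ann. of Math. 175 (2012); M. W. Hirsch, *Differential Topology* (1976), Ch. 5 §1.
-/

-- the prescribed namespace `Summit.SmoothPoincare4.SmoothPoincare4.…` repeats `SmoothPoincare4`
set_option linter.dupNamespace false

noncomputable section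

open Bundle Set Function Filter MeasureTheory Module
open scoped Manifold ContDiff Topology RealInnerProductSpace BigOperators ENNReal NNReal

namespace Summit.SmoothPoincare4.SmoothPoincare4.Cruxes.CylinderRungTwo.KillingFlux

open Literature.Geometry.Riemannian Literature.Geometry.Riemannian.EuclideanHypersurface
open Literature.Geometry.Lorentzian Literature.Geometry.Lorentzian.PseudoRiemannianMetric
open Literature.Geometry.Riemannian.SphericalCylinderEntropy (cylEntropy cylDensity truncL truncL_apply
  hausdorffMeasure_sphere_four_pos hausdorffMeasure_sphere_four_lt_top)
open Summit.SmoothPoincare4.SmoothPoincare4.Theorems.GoodPoints (exists_goodSet)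
open Summit.SmoothPoincare4.SmoothPoincare4.Theorems.CylinderRungTwo.KillingFlux (helper_crossingParityOfPocket)


/-! ### Real-arithmetic book-keeping of the final contradiction -/

/-- The final contradiction of the areas in degree zero: total `= κ · area ≥ κ v` (floor), total `≤ good + bad`,
`(1 - ξ) good ≤ bad`, `bad ≤ κ v ε/4`, `ξ ≤ ε/4`, `ε ≤ 1`. [folklore] -/
theorem null_area_contradiction {κr v ε ξ Ar μu μG μGc b₁ b₂ : ℝ} (hκ : 0 < κr) (hv : 0 < v)
    (hε1 : ε ≤ 1) (hξ0 : 0 < ξ) (hξε : ξ ≤ ε / 4) (hfl : v ≤ Ar) (hμu : μu = κr * Ar)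
    (hsplit : μu ≤ μG + μGc) (hG : (1 - ξ) * μG ≤ μGc) (hGc : μGc ≤ b₁ + b₂)
    (hb₁ : b₁ ≤ κr * v * ε / 8) (hb₂ : b₂ ≤ κr * v * ε / 8) : False := by
  have hkv : 0 < κr * v := mul_pos hκ hv
  have hξ4 : ξ ≤ 1 / 4 := by linarith
  have hbad : μGc ≤ κr * v / 4 := by nlinarith
  -- `μG ≤ (4/3) μGc`
  have hμG : μG ≤ 4 / 3 * μGc := by
    have h1 : (3 : ℝ) / 4 * μG ≤ (1 - ξ) * μG ∨ μG < 0 := by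
      by_cases hG0 : 0 ≤ μG
      · left; nlinarith
      · right; linarith
    rcases h1 with h1 | h1
    · linarith
    · nlinarith
  have hAr : κr * v ≤ κr * Ar := mul_le_mul_of_nonneg_left hfl hκ.le
  nlinarith

/-! ### The theorem -/

/-- **NULL SURVIVORS DIE** (registered helper `helper_nullSurvivorsDiePocket` of line `killing-flux`; the skeleton's
`nullSurvivorsDie_pocket`, verbatim).  See the module docstring for the statement and the proof.
[cite: Allard1972, §6] [cite: HirschDT1976, Ch. 5 §1] -/
theorem helper_nullSurvivorsDiePocket :
    ¬ ∃ (P : Type) (_ : TopologicalSpace P) (_ : T2Space P) (_ : SecondCountableTopology P)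
        (_ : ChartedSpace (EuclideanSpace ℝ (Fin 4)) P) (_ : IsManifold (𝓡 4) ∞ P) (_ : CompactSpace P)
        (_ : ConnectedSpace P) (_ : MeasurableSpace P) (_ : BorelSpace P)
        (F : ℝ → P → EuclideanSpace ℝ (Fin 6)) (ν : ℝ → P → EuclideanSpace ℝ (Fin 6)) (T : ℝ),
        IsCylinderMCF P F ν T ∧ (∀ t, T ≤ t → cylEntropy (Set.range (F t)) < 2) ∧
          (∀ t, T ≤ t → ¬ SeparatesEnds (Set.range (F t))) ∧
          (∀ t, T ≤ t → ∃ (z : EuclideanSpace ℝ (Fin 6)) (R : ℝ), ∑ i : Fin 5, z (Fin.castSucc i) ^ 2 = 1 ∧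
            z ∉ Set.range (F t) ∧ ∀ b : EuclideanSpace ℝ (Fin 6), ∑ i : Fin 5, b (Fin.castSucc i) ^ 2 = 1 → b 5 ≤ -R →
              ¬ JoinedIn ({z : EuclideanSpace ℝ (Fin 6) | ∑ i : Fin 5, z (Fin.castSucc i) ^ 2 = 1} \ Set.range (F t)) z b) := by
  rintro ⟨M, _, _, _, _, _, _, _, _, _, F, ν, T, hF, hthin, hnsep, hpocket⟩
  -- a fixed accuracy `ε = 1`
  obtain ⟨ε, hε, hε1⟩ : ∃ ε : ℝ, 0 < ε ∧ ε ≤ 1 := ⟨1, one_pos, le_rfl⟩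
  -- `M` is non-empty (connected)
  have hM : Nonempty M := inferInstance
  -- THE PARABOLIC AREA FLOOR along the immortal flow (where immortality is consumed)
  have hfloor : ∀ t, T ≤ t →
      μH[4] (Metric.sphere (0 : EuclideanSpace ℝ (Fin 5)) 1) ≤ μH[4] (Set.range (F t)) := fun t ht =>
    helper_volLeAreaAlongCylinderFlow M F ν T hF t ht
  -- the volume of the slice and the normalising constant
  have hvol0 := (hausdorffMeasure_sphere_four_pos).ne'
  have hvoltop := (hausdorffMeasure_sphere_four_lt_top).ne
  obtain ⟨v, hvdef⟩ : ∃ v : ℝ, v = (μH[4] (Metric.sphere (0 : EuclideanSpace ℝ (Fin 5)) 1)).toReal := ⟨_, rfl⟩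
  have hv : 0 < v := by rw [hvdef]; exact ENNReal.toReal_pos hvol0 hvoltop
  set κ₄ : ℝ≥0 := Measure.addHaarScalarFactor (volume : Measure (EuclideanSpace ℝ (Fin 4)))
    (μH[(4 : ℕ)] : Measure (EuclideanSpace ℝ (Fin 4))) with hκ₄
  have hκ0 : κ₄ ≠ 0 := Measure.addHaarScalarFactor_volume_hausdorffMeasure_ne_zero 4
  have hκr : 0 < (κ₄ : ℝ) := NNReal.coe_pos.2 (pos_iff_ne_zero.2 hκ0)
  -- universal constants
  obtain ⟨Nb, hNb⟩ := exists_goodSet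
  obtain ⟨c₁, c₂, hc₁, hc₂, hcut⟩ := exists_heightCutoff
  -- flow constants
  obtain ⟨δ₀, hδ₀, hδ₀h, τmax, hτmax, s₀, hs₀T, hup⟩ :=
    helper_upperGaussianDensityLateOfFloor M F ν T hF hfloor hthin
  obtain ⟨CA, hCA, R₀, hR₀, hAhl⟩ := ahlforsGrowth_of_thin
  obtain ⟨B, hB⟩ := hF.exists_height_bound
  obtain ⟨Atot, hAtotdef⟩ : ∃ A : ℝ, A = ((μHE[4] : Measure (EuclideanSpace ℝ (Fin 6))) (Set.range (F T))).toReal :=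
    ⟨_, rfl⟩
  have hAtot0 : 0 ≤ Atot := by rw [hAtotdef]; exact ENNReal.toReal_nonneg
  obtain ⟨CG, hCGdef⟩ : ∃ CG : ℝ, CG = 2048 * Real.exp (1 / 16) * CA / Real.pi ^ 2 + Atot / R₀ ^ 4 := ⟨_, rfl⟩
  have hCG0 : 0 ≤ CG := by rw [hCGdef]; positivity
  -- the stacking parameters, with tilt threshold `ξ ≤ ε/4`
  obtain ⟨η, Λ₁, C₀sq, Kρ, κ, ξ, θ, W₀, gmax, hη, -, hC₀, hKρ, hκ, hξ, hξε, hξh, hθ, hW₀, hgmax, hpar⟩ :=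
    exists_stackingParameters hδ₀ (by linarith) hτmax hR₀ hCA hCG0 hc₁.le hc₂.le (by positivity : (0 : ℝ) < ε / 4)
  -- lateness: heights within `gmax/2` of a constant
  obtain ⟨ch, hch⟩ := helper_heightsConverge M F ν T hF hthin
  obtain ⟨sh, hshT, hheight⟩ := hch (gmax / 2) (by positivity)
  -- lateness: small Willmore energy
  obtain ⟨e₀, he₀def⟩ : ∃ e : ℝ, e = ξ * ((κ₄ : ℝ) * v * ε) / (8 * ((Nb : ℝ) + 1)) := ⟨_, rfl⟩
  have he₀ : 0 < e₀ := by rw [he₀def]; positivity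
  obtain ⟨W₁, hW₁def⟩ : ∃ W : ℝ, W = min W₀ (min (θ * ((κ₄ : ℝ) * v * ε) / (8 * ((Nb : ℝ) + 1)))
    ((e₀ / (|B| + 1)) ^ 2 / (Atot + 1))) := ⟨_, rfl⟩
  have hW₁ : 0 < W₁ := by rw [hW₁def]; positivity
  have hW₁a : W₁ ≤ W₀ := by rw [hW₁def]; exact min_le_left _ _
  have hW₁b : W₁ ≤ θ * ((κ₄ : ℝ) * v * ε) / (8 * ((Nb : ℝ) + 1)) := by
    rw [hW₁def]; exact (min_le_right _ _).trans (min_le_left _ _)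
  have hW₁c : W₁ ≤ (e₀ / (|B| + 1)) ^ 2 / (Atot + 1) := by
    rw [hW₁def]; exact (min_le_right _ _).trans (min_le_right _ _)
  obtain ⟨r, hrT, hr₁, hWr⟩ := exists_late_smallWillmore hF hW₁ (s₁ := max (max s₀ sh) T) (le_max_right _ _)
  have hrs₀ : s₀ ≤ r := (le_max_left _ _).trans ((le_max_left _ _).trans hr₁)
  have hrsh : sh ≤ r := (le_max_right _ _).trans ((le_max_left _ _).trans hr₁)
  -- the slice at time `r`
  have hf := hF.isSpacelikeImmersion r hrT
  have hemb := hF.isSmoothEmbedding r hrT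
  have hν := hF.contMDiff_normal r hrT
  have hun := hF.isUnitNormal r hrT
  have hN := hF.mem_cyl r hrT
  have hνN := hF.normal_tangent r hrT
  set g₁ := (euclideanMetric (EuclideanSpace ℝ (Fin 6))).inducedRiemannianMetric (F r)
    contMDiff_pullbackBilin_holds hf with hg₁
  set μ := riemannianMeasure g₁ with hμ
  haveI : IsFiniteMeasure μ := isFiniteMeasure_riemannianMeasure g₁
  set Hm : M → ℝ := fun w => (euclideanMetric (EuclideanSpace ℝ (Fin 6))).meanCurvature (F r)
    contMDiff_pullbackBilin_holds hf (ν r) w with hHm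
  set S : M → ℝ := fun w => ∑ i : Fin 5, ν r w (Fin.castSucc i) ^ 2 with hS
  have hfc : Continuous (F r) := hf.contMDiff_self.continuous
  have hνc : Continuous (ν r) := hν.continuous
  have hHc : Continuous Hm := continuous_meanCurvature_euclidean hf hν
  have hSc : Continuous S := by
    refine continuous_finsetSum _ fun i _ => ?_
    exact ((EuclideanSpace.proj (Fin.castSucc i) : EuclideanSpace ℝ (Fin 6) →L[ℝ] ℝ).continuous.comp hνc).pow 2
  have hS0 : ∀ w, 0 ≤ S w := fun w => Finset.sum_nonneg fun i _ => sq_nonneg _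
  have hSi : Integrable S μ := integrable_of_continuous (h := g₁) hSc
  have hHi : Integrable (fun w => Hm w ^ 2) μ := integrable_of_continuous (h := g₁) (hHc.pow 2)
  have hνunit : ∀ w, ‖ν r w‖ = 1 := fun w => norm_eq_one_of_isUnitNormal hun w
  have hS1 : ∀ w, S w = 1 - ν r w 5 ^ 2 := fun w => by
    have h := norm_sq_eq_sum_castSucc_add_sq (ν r w)
    rw [hνunit w, one_pow] at h
    simp only [hS]; linarith
  -- Willmore and tilt at time `r`
  have hWW : ∫ w, Hm w ^ 2 ∂μ ≤ W₁ := hWr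
  have hW0 : 0 ≤ ∫ w, Hm w ^ 2 ∂μ := integral_nonneg fun w => sq_nonneg _
  have hμuniv : μ Set.univ = (κ₄ : ℝ≥0∞) * μH[4] (Set.range (F r)) := hF.riemannianMeasure_univ_eq_smul hrT
  have hμreal : μ.real Set.univ ≤ Atot := by rw [hAtotdef]; exact hF.riemannianMeasure_real_univ_le_initial hrT
  have hE : ∫ w, S w ∂μ ≤ e₀ := by
    have h1 : ∫ w, S w ∂μ = ∫ w, (1 - ν r w 5 ^ 2) ∂μ := integral_congr_ae (Eventually.of_forall hS1)
    have h2 := tiltExcess_le_sqrt_of_abs_height_le hf hν hun hN hνN (hB r hrT)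
    rw [h1]
    refine tilt_budget h2 measureReal_nonneg ?_ hW0 (hWW.trans hW₁c) he₀.le
    simpa [measureReal_def] using hμreal
  -- the good set
  obtain ⟨G, hGm, hGpt, hGtilt, hGH, hGbad⟩ := hNb M μ (F r) hfc S (fun w => Hm w ^ 2) hSc (hHc.pow 2) hS0
    (fun w => sq_nonneg _) hSi hHi ξ θ R₀ hξ hθ
  -- the height gap at time `r`
  have hgap : ∀ x x' : M, F r x' 5 - F r x 5 ≤ gmax := fun x x' => by
    have h1 := hheight r hrsh x
    have h2 := hheight r hrsh x'
    rw [abs_lt] at h1 h2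
    linarith
  -- the shadow is injective on the good set
  have hinj : InjOn (fun x => truncL (F r x)) G :=
    shadow_injOn_of_good hf hemb hν hun hN hνN hδ₀ (by linarith) hR₀ hCA hξ hθ hη hC₀ hKρ hκ hcut
      (hAhl M F ν T hF r hrT (hthin r hrT)) hμreal (by rw [hCGdef]) (hWW.trans hW₁a) (hup r hrT hrs₀)
      hgap hpar (fun y hy r' hr' hr'R => ⟨hGtilt y hy r' hr' hr'R, hGH y hy r' hr' hr'R⟩)
  -- the vertical angle on the good set
  have hGpt' : ∀ w ∈ G, 1 - ξ ≤ |ν r w 5| := fun w hw =>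
    one_sub_le_abs_apply_five (hνunit w) (by linarith) (hGpt w hw)
  -- counting IN DEGREE ZERO: crossing parity of the non-separating slice with a pocket
  haveI : Nonempty M := hM
  have hpar := helper_crossingParityOfPocket M (F r) hemb hN
    (fun R => by
      have h := hnsep r hrT
      by_contra hcon
      refine h ⟨R, fun a b ha hb haR hRb hj => hcon ⟨a, b, ha, hb, haR, hRb, ?_⟩⟩
      simpa [cylN] using hj)
    (hpocket r hrT) (ν r) hνc hun hνN
  have hcount := helper_parityCounting M (F r) (ν r) hemb hf hN hνc hun hνN hpar G hGm (1 - ξ)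
    (by linarith : 0 < 1 - ξ) hGpt' hinj
  -- pass to real numbers
  have hArtop : μH[4] (Set.range (F r)) ≠ ⊤ :=
    (Literature.Geometry.Riemannian.SphericalCylinderEntropy.hausdorffMeasure_range_lt_top_of_isSpacelikeImmersion
      hf (hF.injective hrT)).ne
  -- (a) the floor at time `r`
  have hflr : v ≤ (μH[4] (Set.range (F r))).toReal := by
    rw [hvdef]
    exact ENNReal.toReal_mono hArtop (hfloor r hrT)
  -- (b) total area
  have hμu : μ.real Set.univ = (κ₄ : ℝ) * (μH[4] (Set.range (F r))).toReal := by
    rw [measureReal_def, hμuniv, ENNReal.toReal_mul, ENNReal.coe_toReal]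
  -- (c) splitting
  have hsplit : μ.real Set.univ ≤ μ.real G + μ.real Gᶜ := by
    rw [← Set.union_compl_self G]
    exact measureReal_union_le _ _
  -- (d) the good part is dominated by the bad part
  have hG : (1 - ξ) * μ.real G ≤ μ.real Gᶜ := by
    have htop : μ Gᶜ ≠ ⊤ := measure_ne_top μ _
    have h := ENNReal.toReal_mono htop hcount
    rwa [ENNReal.toReal_mul, ENNReal.toReal_ofReal (by linarith), ← measureReal_def, ← measureReal_def] at h
  -- (e) the bad part
  have hb₁ : ((Nb : ℝ) + 1) * ((∫ w, S w ∂μ) / ξ) ≤ (κ₄ : ℝ) * v * ε / 8 := by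
    have h1 : ((Nb : ℝ) + 1) * ((∫ w, S w ∂μ) / ξ) ≤ ((Nb : ℝ) + 1) * (e₀ / ξ) :=
      mul_le_mul_of_nonneg_left (div_le_div_of_nonneg_right hE hξ.le) (by positivity)
    have h2 : ((Nb : ℝ) + 1) * (e₀ / ξ) = (κ₄ : ℝ) * v * ε / 8 := by
      rw [he₀def]; field_simp
    linarith
  have hb₂ : (Nb : ℝ) * ((∫ w, Hm w ^ 2 ∂μ) / θ) ≤ (κ₄ : ℝ) * v * ε / 8 := by
    have h1 : (Nb : ℝ) * ((∫ w, Hm w ^ 2 ∂μ) / θ) ≤ (Nb : ℝ) * (W₁ / θ) :=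
      mul_le_mul_of_nonneg_left (div_le_div_of_nonneg_right hWW hθ.le) (Nat.cast_nonneg _)
    have h2 : (Nb : ℝ) * (W₁ / θ) ≤ (Nb : ℝ) * ((θ * ((κ₄ : ℝ) * v * ε) / (8 * ((Nb : ℝ) + 1))) / θ) :=
      mul_le_mul_of_nonneg_left (div_le_div_of_nonneg_right hW₁b hθ.le) (Nat.cast_nonneg _)
    have h3 : (Nb : ℝ) * ((θ * ((κ₄ : ℝ) * v * ε) / (8 * ((Nb : ℝ) + 1))) / θ) =
        (Nb : ℝ) / ((Nb : ℝ) + 1) * ((κ₄ : ℝ) * v * ε / 8) := by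
      field_simp
    have h4 : (Nb : ℝ) / ((Nb : ℝ) + 1) ≤ 1 := by
      rw [div_le_one (by positivity)]; linarith
    have h5 : (Nb : ℝ) / ((Nb : ℝ) + 1) * ((κ₄ : ℝ) * v * ε / 8) ≤ 1 * ((κ₄ : ℝ) * v * ε / 8) :=
      mul_le_mul_of_nonneg_right h4 (by positivity)
    linarith
  exact null_area_contradiction hκr hv hε1 hξ hξε hflr hμu hsplit hG hGbad hb₁ hb₂

end Summit.SmoothPoincare4.SmoothPoincare4.Cruxes.CylinderRungTwo.KillingFlux

end
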